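import Summits.BirchSwinnertonDyer.Rank1Residual.Partition.MainConjecturesEisenstein
import Summits.BirchSwinnertonDyer.Rank1Residual.X2.RankOneManin
import Summits.BirchSwinnertonDyer.Rank1Residual.X11b.TwistTransportTam
import Summits.BirchSwinnertonDyer.Rank1Residual.X11b.TamagawaQuadraticBaseChange
import Summits.BirchSwinnertonDyer.Rank1Residual.AdditivePotMult.RankOneHeegnerAnyPrime
import Literature.NumberTheory.EllipticCurves.CastellaGrossiLeeSkinner2022.HeegnerIndexIdentity
import Literature.NumberTheory.Automorphic.ShimuraCurveRibetTakahashiOptimalModularityProofs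
import Literature.NumberTheory.EllipticCurves.BSDSelmerCMPConverseMaximalOrderProofs
import HarnessLib

/-!
# Row C6 (good non-anomalous Eisenstein `p`), rank ONE, along its PRINTED anticyclotomic route at
# the level of CGLS22's display (5.5): the Heegner-index identity OVER `K` ⇒ `X11b.IndexIdentityAt`
# ⇒ (tree descent) `BSD(E,p)` — companion of `Partition/MainConjecturesEisenstein.lean` §4

HONEST FRAMING (cell `b2b-bsdres`, run/shared/lean/b2b/bsd-rank1-residual/; verbatim): the goal is to
DELETE the COMBINATION-SHAPED residual classes for ALL analytic-rank `≤ 1` curves over `ℚ` — "full BSD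
formula for every rank `≤ 1` curve in class `C`" assembled STRICTLY from published theorems — so
that the rank-`≤ 1` remainder becomes exactly the CONSTRUCTION-SHAPED classes, which are TYPED
(missing-input `Prop`s), NOT attempted; this is not "finishing BSD". NEW WORK of the cell (bookkeeping
over decls already in the tree), hence under `Summits/`; NO definition, NO named fact, nothing about
any particular curve asserted; no label moves (row C6 is COVERED [PUB] by CGS 2025 Thm. D, A47).
Unit `b2b-bsdres-lit-cgls` (off-peak literature typer: Castella–Grossi–Lee–Skinner 2022 /
Greenberg–Vatsal 2000), session 3.

## What this file does

`Partition/MainConjecturesEisenstein.lean` §4 (session 2) carried row C6 ∩ {r = 1} along the printed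
route at the level of CGLS22's display **(5.7)** (the identity OVER `ℚ`, AFTER Gross–Zagier). The
Literature file `CastellaGrossiLeeSkinner2022/HeegnerIndexIdentity.lean` (session 3) types the display
one step UP the printed chain, **(5.5)** — the identity OVER `K` that the anticyclotomic package
(Thm. 4.2.2 BDP main conjecture + Thm. 5.1.1 control + Thm. 5.1.3 BDP formula) delivers:
`ord_p #Ш(E/K) = 2·ord_p(c_E⁻¹·[E(K):ℤ.P_K]) − Σ_{w∣N} ord_p c_w(E/K)`, Manin constant INCLUDED
(`CastellaGrossiLeeSkinner2022.display55_sha_heegnerIndex`). This file binds it to the cell's shared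
rank-one currency and descends IN THE KERNEL:

1. `RowC6.indexIdentityAt_of_display55` — at a Heegner datum with `p ∤ c_E` (and `p ≥ 5`, for the
   Tamagawa transport `ord_p ∏_w c_w(E/K) = 2·ord_p ∏_ℓ c_ℓ(E/ℚ)`,
   `X11b.padicValNat_tamagawaProduct_baseChange_quadratic_eq_two_mul`): (5.5) ⇒
   `X11b.IndexIdentityAt W p K P` — the predicate of the irreducible multiplicative class X11b
   (`X11b/BDPRoute.lean`) and the body of the TYPED input `X2.HeegnerIndexIdentity` of the reducible
   multiplicative sub-cell X2c (`X2/RankOneHeegner.lean`, whose docstring says "At a GOOD Eisenstein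
   prime this is Castella–Grossi–Lee–Skinner 2022 Thm. 5.3.1": now a citation —
   `RowC6.heegnerIndexIdentity_good_of_display55` is that good-prime twin AS A THEOREM from the
   typed display); a fortiori STEP L (`RowC6.indexLowerBoundAt_of_display55`).
2. `RowC6.bsdp_rankOne_at_of_display55_of_partner` — POINTWISE at a datum: (5.5) + the rank-zero
   print shape of the twist `E^{(d_K)}` + Gross–Zagier + Kolyvagin ⇒ `BSD(E,p)`, by the cell's EXACT
   descent `X11b.bsdp_of_indexIdentityAt` (multr1-p2; torsion included), with the two decidable
   transport values DISCHARGED (`X11b.padicValNat_tamagawaProduct_twist_of_heegner`, `p ≥ 5`;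
   `AdditivePotMult.padicValRat_u_eq_zero_of_twist_minimal_of_split`, `p` split) and `w_K = 2`
   (`X2.not_dvd_unitsTorsionOrder_of_discr_lt`).
3. `RowC6.bsdp_rankOne_at_of_display55_of_cgsThmA` — the partner SUPPLIED: `E^{(d_K)}` is again good,
   Eisenstein and non-anomalous at the split `p` (`CastellaGrossiLeeSkinner2022.partner_good_red_not_anom`),
   so CGS 2025 Theorem A (typed, A142) + Greenberg Thm. 4.1 give its rank-zero print shape
   (`CastellaGrossiSkinner2025.pPartRankZero_of_thmA`) — "applying our result in the rank `0` case to
   `E^K`" (CGS Thm. D's proof).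
4. `RowC6.bsdp_rankOne_of_display55_of_cgsThmA` — CLASS LEVEL, NO per-pair binder: for every
   globally minimal `E/ℚ` with `ord_{s=1}L(E,s) = 1` and every good Eisenstein `p ≥ 5` with
   `a_p ≢ 1 (mod p)`: `BSD(E,p)` from the typed display (5.5), the typed Theorem A and PUBLISHED named
   facts only — the admissible `K` by Hoffstein–Luo (`exists_admissibleField_of_rootNumber_eq_neg_one`),
   the Manin condition moved to the `X₀(N)`-OPTIMAL curve of the isogeny class (minimal-degree datum
   `exists_optimal_modularParametrizationData_of_modularity` + Mazur 1978 Cor. 4.1 `hMaz`, `p` odd,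
   `p ∤ N`), which is again in row C6 (`Red`, `Good`, `a_p`, `ord_{s=1}L` are isogeny invariants), and
   Cassels' isogeny invariance of `BSD(·,p)` (`X2.bsdp_of_isIsogenous_of_bsdp`) — exactly the device
   of `X2/RankOneManin.lean` for X2c. At an Eisenstein prime the non-optimal members of the class may
   be reachable only through a `p`-isogeny, so `p ∤ c_E` is NOT automatic for them: this is why CGLS
   keep `c_E` in (5.5)–(5.6) (it cancels in (5.7)), and why the kernel route goes through the optimal
   curve.

Net effect for the PARTITION / RESIDUAL-MAP: row C6 ∩ {r = 1, p ≥ 5} reads, in the kernel, "(5.5)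
[= BDP-IMC + control + BDP formula, PRINTED] ⇒ Heegner-index identity over `K` (the X11b/X2c currency) ⇒
exact descent ⇒ BSD_p, twist input = CGS Theorem A (typed MC)" — the shape of lit-glue's
`X11b.bsdp_rankOne_of_indexLowerBoundAt_of_goodOrd_twist` (row C3) with the STEP-L input PRINTED.
`p = 3` stays on the (5.7) route of `MainConjecturesEisenstein.lean` §4 (the base-change Tamagawa
transport is a tree theorem at `p ≥ 5`). Nothing is upgraded on X1 (anomalous) or X2 (multiplicative).
References: [CastellaGrossiLeeSkinner2022] proof of Thm. 5.3.1 (5.4)–(5.7), Thms. 4.2.2, 5.1.1–5.1.4;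
[CastellaGrossiSkinner2025] Thm. A, Thm. D; [JetchevSkinnerWan2017] §7.4.1; [GrossZagier1986] V.§2;
[Mazur1978] Cor. 4.1; [MilneADT2006] I.7.3; [GreenbergLNM1716] Thm. 4.1; [HoffsteinLuo1997];
[Miller2011LMS] Def. 1.1. Deliverable: HOME/b2b-bsdres-lit-cgls/CGLS-GV-TYPING.md §10.
-/

set_option autoImplicit false

noncomputable section

open scoped Classical MatrixGroups ModularForm

open CongruenceSubgroup WeierstrassCurve NumberField Literature.NumberTheory.EllipticCurves
  Literature.NumberTheory.EllipticCurves.ModularForms Literature.NumberTheory.QuadraticFields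
  Literature.NumberTheory.EllipticCurves.Rank1Residual
  Literature.NumberTheory.EllipticCurves.Rank1Residual.Typed
  Literature.NumberTheory.EllipticCurves.CastellaGrossiLeeSkinner2022

namespace Summit.BirchSwinnertonDyer.Rank1Residual

/-! ### §1 (5.5) at a datum ⇒ the Heegner-index identity over `K` in the X11b / X2c currency -/

/-- **(5.5) ⇒ `X11b.IndexIdentityAt` at a Heegner datum with Manin constant prime to `p`.** For
`W/ℚ` globally minimal elliptic of conductor `N`, `p ≥ 5` good with `E[p]` reducible and
`a_p ≢ 1 (mod p)`, `ord_{s=1}L(E,s) = 1`, an admissible `K` ((a)–(d) of CGLS Thm. 5.3.1's proof: `d_K`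
odd `< −4`, every `ℓ ∣ N` split, `p` split, `L(E^{(d_K)},1) ≠ 0`), a datum `Dt` of level `N` with
`p ∤ c(Dt)` and its Heegner point `P`: if `Ш(E/K)` is finite then
`2·ord_p ∏_ℓ c_ℓ(E/ℚ) + ord_p #Ш(E/K) = 2·ord_p [E(K):ℤ·P]`. Proof: the typed display (`h55`) through
`indexIdentity_of_display55`, the Tamagawa transport `ord_p ∏_w c_w(E/K) = 2·ord_p ∏_ℓ c_ℓ(E/ℚ)` being
the tree theorem `X11b.padicValNat_tamagawaProduct_baseChange_quadratic_eq_two_mul` (`p ≥ 5`; its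
bad-prime proviso is vacuous since every `ℓ ∣ N` splits).
[cite: CastellaGrossiLeeSkinner2022, proof of Thm. 5.3.1, display (5.5)]
[cite: JetchevSkinnerWan2017, §7.3.1 (eq:tamK) and §7.4.1] -/
theorem RowC6.indexIdentityAt_of_display55 (h55 : display55_sha_heegnerIndex)
    (W : WeierstrassCurve ℚ) [W.IsElliptic] [W.IsGloballyMinimal] (p : ℕ) [Fact p.Prime]
    (N : ℕ) [NeZero N] (K : Type) [Field K] [NumberField K]
    (Dt : ModularParametrizationData W N) (H : HeegnerDatum N (NumberField.discr K)) (ι : K →+* ℂ)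
    (P : (W.baseChange K).toAffine.Point)
    (hp5 : 5 ≤ p) (hgood : Good W p) (hred : Red W p) (hna : ¬ Anom W p) (hr : W.analyticRank = 1)
    (hN : W.conductorNorm ℤ = N) (hK : IsImaginaryQuadratic K) (hodd : Odd (NumberField.discr K))
    (hlt : NumberField.discr K < -4) (hHN : SatisfiesHeegnerHypothesis N K)
    (hHp : SatisfiesHeegnerHypothesis p K)
    (hLt : (W.quadraticTwist (NumberField.discr K : ℚ)).entireLFunction 1 ≠ 0)
    (hP : WeierstrassCurve.Affine.Point.map ι.toRatAlgHom P = heegnerPointComplex Dt H)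
    (hc : ¬ (p : ℤ) ∣ Dt.c) (hfin : Finite (W.baseChange K).sha) :
    X11b.IndexIdentityAt W p K P := by
  have hp2 : 2 < p := by omega
  have hHN' : SatisfiesHeegnerHypothesis (W.conductorNorm ℤ) K := by rw [hN]; exact hHN
  -- the Tamagawa transport (every `ℓ ∣ N` splits: the bad-prime proviso is vacuous)
  have htamK : padicValNat p (W.baseChange K).tamagawaProduct = 2 * padicValNat p W.tamagawaProduct :=
    X11b.padicValNat_tamagawaProduct_baseChange_quadratic_eq_two_mul W p K hp5 hK.1
      (fun ℓ _ hℓN hns ↦ (hns (hHN' ℓ Fact.out hℓN)).elim)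
  exact (X11b.indexIdentityAt_iff W p K P).mpr
    (indexIdentity_of_display55 h55 hp2 hgood hred hna hr K hK hodd hlt hHN' hHp hLt Dt H ι P hP hc
      htamK hfin)

/-- **(5.5) ⇒ STEP L (`X11b.IndexLowerBoundAt`) at the same datum** — the identity implies the lower
bound (`X11b.indexLowerBoundAt_of_indexIdentityAt`). At a GOOD non-anomalous Eisenstein `p ≥ 5` the
STEP-L input of the rank-one rows is thus PRINT, not typed.
[cite: CastellaGrossiLeeSkinner2022, proof of Thm. 5.3.1, display (5.5)]
[cite: JetchevSkinnerWan2017, §7.4.1 (eq:shalowerK-1)] -/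
theorem RowC6.indexLowerBoundAt_of_display55 (h55 : display55_sha_heegnerIndex)
    (W : WeierstrassCurve ℚ) [W.IsElliptic] [W.IsGloballyMinimal] (p : ℕ) [Fact p.Prime]
    (N : ℕ) [NeZero N] (K : Type) [Field K] [NumberField K]
    (Dt : ModularParametrizationData W N) (H : HeegnerDatum N (NumberField.discr K)) (ι : K →+* ℂ)
    (P : (W.baseChange K).toAffine.Point)
    (hp5 : 5 ≤ p) (hgood : Good W p) (hred : Red W p) (hna : ¬ Anom W p) (hr : W.analyticRank = 1)
    (hN : W.conductorNorm ℤ = N) (hK : IsImaginaryQuadratic K) (hodd : Odd (NumberField.discr K))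
    (hlt : NumberField.discr K < -4) (hHN : SatisfiesHeegnerHypothesis N K)
    (hHp : SatisfiesHeegnerHypothesis p K)
    (hLt : (W.quadraticTwist (NumberField.discr K : ℚ)).entireLFunction 1 ≠ 0)
    (hP : WeierstrassCurve.Affine.Point.map ι.toRatAlgHom P = heegnerPointComplex Dt H)
    (hc : ¬ (p : ℤ) ∣ Dt.c) (hfin : Finite (W.baseChange K).sha) :
    X11b.IndexLowerBoundAt W p K P :=
  X11b.indexLowerBoundAt_of_indexIdentityAt W p K P
    (RowC6.indexIdentityAt_of_display55 h55 W p N K Dt H ι P hp5 hgood hred hna hr hN hK hodd hlt hHN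
      hHp hLt hP hc hfin)

/-- **The GOOD-prime twin of the typed input `X2.HeegnerIndexIdentity`, as a THEOREM from the typed
display (5.5)** (same binder shape with "`p ∥ N`" replaced by "good, `a_p ≢ 1 (mod p)`, `p` split in
`K`", and `p ≥ 5` for the Tamagawa transport): the sentence "At a GOOD Eisenstein prime this is
Castella–Grossi–Lee–Skinner 2022 Thm. 5.3.1" of `X2/RankOneHeegner.lean`, in the kernel.
[cite: CastellaGrossiLeeSkinner2022, proof of Thm. 5.3.1, display (5.5)] -/
theorem RowC6.heegnerIndexIdentity_good_of_display55 (h55 : display55_sha_heegnerIndex) :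
    ∀ (W : WeierstrassCurve ℚ) [W.IsElliptic] [W.IsGloballyMinimal] (p : ℕ) [Fact p.Prime]
      (N : ℕ) [NeZero N] (K : Type) [Field K] [NumberField K]
      (Dt : ModularParametrizationData W N) (H : HeegnerDatum N (NumberField.discr K)) (ι : K →+* ℂ)
      (P : (W.baseChange K).toAffine.Point),
      5 ≤ p → Good W p → Red W p → ¬ Anom W p → W.analyticRank = 1 → W.conductorNorm ℤ = N →
      IsImaginaryQuadratic K → Odd (NumberField.discr K) → NumberField.discr K < -4 →
      SatisfiesHeegnerHypothesis N K → SatisfiesHeegnerHypothesis p K →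
      (W.quadraticTwist (NumberField.discr K : ℚ)).entireLFunction 1 ≠ 0 →
      WeierstrassCurve.Affine.Point.map ι.toRatAlgHom P = heegnerPointComplex Dt H →
      ¬ (p : ℤ) ∣ Dt.c → Finite (W.baseChange K).sha → X11b.IndexIdentityAt W p K P :=
  fun W _ _ p _ N _ K _ _ Dt H ι P hp5 hgood hred hna hr hN hK hodd hlt hHN hHp hLt hP hc hfin ↦
    RowC6.indexIdentityAt_of_display55 h55 W p N K Dt H ι P hp5 hgood hred hna hr hN hK hodd hlt hHN
      hHp hLt hP hc hfin

/-! ### §2 Pointwise: (5.5) + the twist's rank-zero print shape ⇒ `BSD(E,p)` (exact descent in the tree) -/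

/-- **Row C6 ∩ {r = 1} at a Heegner datum, from (5.5) and the partner's rank-zero print shape.**
Data: `W/ℚ` globally minimal elliptic of conductor `N`, `p ≥ 5` good Eisenstein non-anomalous,
`ord_{s=1}L(E,s) = 1`; `K` admissible ((a)–(d)); a datum `Dt` of level `N` with `p ∤ c(Dt)`, its
Heegner point `P`; a globally minimal model `Wd = Cd • E^{(d_K)}` with `PPartRankZero Wd p`. Published
binders: Gross–Zagier (`hGZ`), Kolyvagin (`hKo`), GZK (`hGZK`), modularity (`hmod`). Conclusion
`BSDp W p`, by `X11b.bsdp_of_indexIdentityAt` (the exact descent `K → ℚ`, torsion included) fed with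
(5.5) (`RowC6.indexIdentityAt_of_display55`), `w_K = 2` (`X2.not_dvd_unitsTorsionOrder_of_discr_lt`)
and the two transport values, here THEOREMS: `ord_p ∏c(E^{(d_K)}) = ord_p ∏c(E)`
(`X11b.padicValNat_tamagawaProduct_twist_of_heegner`, `p ≥ 5`) and `ord_p u(Cd) = 0`
(`AdditivePotMult.padicValRat_u_eq_zero_of_twist_minimal_of_split`, `p` split in `K`).
[cite: CastellaGrossiLeeSkinner2022, proof of Thm. 5.3.1, (5.5)–(5.7)]
[cite: JetchevSkinnerWan2017, §7.4.1 (eq:gz for K′), p. 30] [cite: Miller2011LMS, Def. 1.1] -/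
theorem RowC6.bsdp_rankOne_at_of_display55_of_partner (h55 : display55_sha_heegnerIndex)
    (W : WeierstrassCurve ℚ) [W.IsElliptic] [W.IsGloballyMinimal] (p : ℕ) [Fact p.Prime]
    (N : ℕ) [NeZero N] (K : Type) [Field K] [NumberField K]
    (Dt : ModularParametrizationData W N) (H : HeegnerDatum N (NumberField.discr K)) (ι : K →+* ℂ)
    (P : (W.baseChange K).toAffine.Point)
    -- the published inputs (named facts of the tree)
    (hGZ : gross_zagier N W K) (hKo : kolyvagin N W K)
    (hGZK : rank_eq_analyticRank_of_analyticRank_le_one) (hmod : hasEntireLFunction_rat)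
    -- the pair and the Heegner data
    (hp5 : 5 ≤ p) (hgood : Good W p) (hred : Red W p) (hna : ¬ Anom W p) (hr : W.analyticRank = 1)
    (hN : W.conductorNorm ℤ = N) (hK : IsImaginaryQuadratic K) (hodd : Odd (NumberField.discr K))
    (hlt : NumberField.discr K < -4) (hHN : SatisfiesHeegnerHypothesis N K)
    (hHp : SatisfiesHeegnerHypothesis p K)
    (hLt : (W.quadraticTwist (NumberField.discr K : ℚ)).entireLFunction 1 ≠ 0)
    (hP : WeierstrassCurve.Affine.Point.map ι.toRatAlgHom P = heegnerPointComplex Dt H)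
    (hc : ¬ (p : ℤ) ∣ Dt.c)
    -- a globally minimal model of the twist and its rank-zero print shape
    (Wd : WeierstrassCurve ℚ) [Wd.IsElliptic] [Wd.IsGloballyMinimal] (Cd : VariableChange ℚ)
    (hWd : Cd • W.quadraticTwist (NumberField.discr K : ℚ) = Wd) (htw : PPartRankZero Wd p) :
    BSDp W p := by
  have hp : p.Prime := Fact.out
  have hp2 : p ≠ 2 := by omega
  have hHN' : SatisfiesHeegnerHypothesis (W.conductorNorm ℤ) K := by rw [hN]; exact hHN
  -- `w_K = 2`, prime to the odd `p`
  have hμ : ¬ p ∣ Units.torsionOrder K := X2.not_dvd_unitsTorsionOrder_of_discr_lt hK hlt hp hp2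
  -- the two transport values, as theorems
  have htam : padicValNat p Wd.tamagawaProduct = padicValNat p W.tamagawaProduct :=
    X11b.padicValNat_tamagawaProduct_twist_of_heegner W p hp5 K hK hHN' Cd hWd
  have hu : padicValRat p (Cd.u : ℚ) = 0 :=
    AdditivePotMult.padicValRat_u_eq_zero_of_twist_minimal_of_split W p K hK hHp Cd hWd
  -- the identity over `K` from (5.5), then the exact descent
  exact X11b.bsdp_of_indexIdentityAt W p N K Dt H ι P hGZ hKo hGZK hmod hK hHN hP hp2 hc hμ hr hLt Wd Cd
    hWd htw htam hu
    (RowC6.indexIdentityAt_of_display55 h55 W p N K Dt H ι P hp5 hgood hred hna hr hN hK hodd hlt hHN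
      hHp hLt hP hc)

/-- **Row C6 ∩ {r = 1} at a Heegner datum, from (5.5) and CGS 2025 Theorem A for the partner** —
"applying our result in the rank `0` case to `E^K`" (proof of CGS Thm. D): the twist `E^{(d_K)}` is
again good, Eisenstein and NON-anomalous at the split prime `p` (`partner_good_red_not_anom`:
`a_p(E^K) = a_p(E)`), has `L(E^{(d_K)},1) ≠ 0`, so Theorem A (`hA`, the typed fact
`CastellaGrossiSkinner2025.thmA_charIdeal_eq_padicLFunction`, A142) with Greenberg's Thm. 4.1 (`hGr`),
modularity (`hmodP`) and GZK gives `PPartRankZero` for it (`CastellaGrossiSkinner2025.pPartRankZero_of_thmA`);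
then `RowC6.bsdp_rankOne_at_of_display55_of_partner`. Every input a named tree fact or the two typed
published statements (5.5) / Thm. A; no `_OPEN` binder.
[cite: CastellaGrossiSkinner2025, Thm. D and its proof (§0.3 p. 5), Theorem A]
[cite: CastellaGrossiLeeSkinner2022, proof of Thm. 5.3.1, (5.5)] [cite: GreenbergLNM1716, Thm. 4.1 (p. 102)] -/
theorem RowC6.bsdp_rankOne_at_of_display55_of_cgsThmA (h55 : display55_sha_heegnerIndex)
    (hA : CastellaGrossiSkinner2025.thmA_charIdeal_eq_padicLFunction)
    (hGr : greenberg_charValue_rankZero) (hmodP : nonempty_modularParametrizationData)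
    (W : WeierstrassCurve ℚ) [W.IsElliptic] [W.IsGloballyMinimal] (p : ℕ) [Fact p.Prime]
    (N : ℕ) [NeZero N] (K : Type) [Field K] [NumberField K]
    (Dt : ModularParametrizationData W N) (H : HeegnerDatum N (NumberField.discr K)) (ι : K →+* ℂ)
    (P : (W.baseChange K).toAffine.Point)
    (hGZ : gross_zagier N W K) (hKo : kolyvagin N W K)
    (hGZK : rank_eq_analyticRank_of_analyticRank_le_one) (hmod : hasEntireLFunction_rat)
    (hp5 : 5 ≤ p) (hgood : Good W p) (hred : Red W p) (hna : ¬ Anom W p) (hr : W.analyticRank = 1)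
    (hN : W.conductorNorm ℤ = N) (hK : IsImaginaryQuadratic K) (hodd : Odd (NumberField.discr K))
    (hlt : NumberField.discr K < -4) (hHN : SatisfiesHeegnerHypothesis N K)
    (hHp : SatisfiesHeegnerHypothesis p K)
    (hLt : (W.quadraticTwist (NumberField.discr K : ℚ)).entireLFunction 1 ≠ 0)
    (hP : WeierstrassCurve.Affine.Point.map ι.toRatAlgHom P = heegnerPointComplex Dt H)
    (hc : ¬ (p : ℤ) ∣ Dt.c)
    (Wd : WeierstrassCurve ℚ) [Wd.IsElliptic] [Wd.IsGloballyMinimal] (Cd : VariableChange ℚ)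
    (hWd : Cd • W.quadraticTwist (NumberField.discr K : ℚ) = Wd) : BSDp W p := by
  have hp : p.Prime := Fact.out
  have hp2 : 2 < p := by omega
  -- `∃ C, C • Wd = E^{(d_K)}` (the inverse change of variables)
  have hWd' : ∃ C : VariableChange ℚ, C • Wd = W.quadraticTwist (NumberField.discr K : ℚ) :=
    ⟨Cd⁻¹, by rw [← hWd, inv_smul_smul]⟩
  -- the partner is good, Eisenstein and non-anomalous at `p`, of analytic rank `0`
  obtain ⟨hgood_d, hred_d, hna_d⟩ :=
    partner_good_red_not_anom hp2 hgood hred hna K hK hodd hHp Wd hWd'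
  have hord_d : GoodOrd Wd p := goodOrd_of_red_of_good Wd p hp2 hgood_d hred_d
  have hd0 : (NumberField.discr K : ℚ) ≠ 0 := by exact_mod_cast NumberField.discr_ne_zero K
  haveI hEt : (W.quadraticTwist (NumberField.discr K : ℚ)).IsElliptic := W.isElliptic_quadraticTwist hd0
  have hLt' : (W.quadraticTwist (NumberField.discr K : ℚ)).entireLFunction = Wd.entireLFunction := by
    rw [← hWd, entireLFunction_smul]
  have hLd : Wd.entireLFunction 1 ≠ 0 := by rw [← hLt']; exact hLt
  -- Theorem A + Greenberg 4.1 + GZK: the rank-zero print shape of the partner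
  have htw : PPartRankZero Wd p :=
    CastellaGrossiSkinner2025.pPartRankZero_of_thmA hA hmodP hGZK Wd p hp2 hgood_d hred_d hna_d hLd
      (fun κ γ hκ hγ hγ' D _ hX fE hfE hSel ↦
        hGr Wd p (by omega) hgood_d hord_d.2 κ γ hκ hγ hγ' D hX fE hfE hSel)
  exact RowC6.bsdp_rankOne_at_of_display55_of_partner h55 W p N K Dt H ι P hGZ hKo hGZK hmod hp5 hgood
    hred hna hr hN hK hodd hlt hHN hHp hLt hP hc Wd Cd hWd htw

/-! ### §3 Class level: the Manin condition moved to the optimal curve (Mazur) and Cassels -/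

/-- **Row C6 is an isogeny-class condition** (globally minimal models): reducibility of `E[p]`, good
reduction at `p`, `a_p` (hence anomaly) and `ord_{s=1}L(E,s)` are `ℚ`-isogeny invariants
(`not_hasIrreducibleModPGaloisRep_of_isIsogenous`, `IsIsogenous.hasGoodReductionAtPrime_iff`,
`frobeniusTrace_eq_of_isIsogenous`, `analyticRank_eq_of_isIsogenous'`). Used to move the Manin
condition to the optimal curve. [cite: SilvermanAEC2009, Cor. VII.7.2 and Ex. 5.4]
[cite: Faltings1983Endlichkeit, §5 Korollar 2] -/
theorem RowC6.of_isIsogenous {W W₀ : WeierstrassCurve ℚ} [W.IsElliptic] [W₀.IsElliptic]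
    [W.IsGloballyMinimal] [W₀.IsGloballyMinimal] {p : ℕ} [Fact p.Prime] (hiso : IsIsogenous W W₀)
    (hgood : Good W p) (hred : Red W p) (hna : ¬ Anom W p) (hr : W.analyticRank = 1) :
    Good W₀ p ∧ Red W₀ p ∧ ¬ Anom W₀ p ∧ W₀.analyticRank = 1 := by
  have hgood₀ : Good W₀ p := (hiso.hasGoodReductionAtPrime_iff p).mp hgood
  have hred₀ : Red W₀ p := not_hasIrreducibleModPGaloisRep_of_isIsogenous hiso hred
  have hr₀ : W₀.analyticRank = 1 := by rw [← analyticRank_eq_of_isIsogenous' hiso]; exact hr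
  refine ⟨hgood₀, hred₀, fun han₀ ↦ hna ⟨hred, hgood, ?_⟩, hr₀⟩
  rw [frobeniusTrace_eq_of_isIsogenous hiso p hgood hgood₀]
  exact han₀.2.2

/-- **Row C6 ∩ {r = 1}, CLASS LEVEL at `p ≥ 5`, along the printed anticyclotomic route at the level of
(5.5): for every globally minimal elliptic `E/ℚ` with `ord_{s=1}L(E,s) = 1` and every GOOD prime
`p ≥ 5` with `E[p]` reducible and `a_p ≢ 1 (mod p)`, Miller's `BSD(E,p)`** — from the typed display
(5.5) (`h55`), the typed CGS Theorem A (`hA`) and PUBLISHED named facts only: Greenberg Thm. 4.1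
(`hGr`), modularity (`hmodP`, `hnf`), Hoffstein–Luo (`hHL`: an admissible `K` with (a)–(d)),
Gross–Zagier / Kolyvagin / Heegner-point rationality (`hGZ`, `hKo`; `heegnerPointComplex_mem_range_map_holds`
is a tree theorem), GZK (`hGZK`), Mazur 1978 Cor. 4.1 (`hMaz`) and Cassels (`hCassels`). NO per-pair
binder. Proof: the `X₀(N)`-OPTIMAL curve `E₀ ∼ E` of the class (minimal-degree datum `D₀`, lattice
`Λ_{E₀} = c₀ Λ_f`) has `p ∤ c₀` (Mazur, `p` odd, `p ∤ N`); `E₀` is again in row C6 with `r = 1`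
(`RowC6.of_isIsogenous`); an admissible `K` for `E₀`, a Heegner datum of discriminant `d_K`, an embedding
and the `K`-rational Heegner point exist (tree theorems); `BSD(E₀,p)` by
`RowC6.bsdp_rankOne_at_of_display55_of_cgsThmA`; `BSD(E,p)` by Cassels (`X2.bsdp_of_isIsogenous_of_bsdp`).
The same device as `X2/RankOneManin.lean` (reducible multiplicative twin, typed input) — here the
over-`K` input is PRINT. `p = 3` stays on the (5.7) route (`RowC6.bsdp_rankOne_of_display57_of_cgsThmA`).
[cite: CastellaGrossiLeeSkinner2022, proof of Thm. 5.3.1, (5.4)–(5.7)]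
[cite: CastellaGrossiSkinner2025, Thm. D and its proof (§0.3 p. 5), Theorem A]
[cite: Mazur1978, Cor. 4.1] [cite: MilneADT2006, Thm. I.7.3] [cite: HoffsteinLuo1997, Theorem (§1)]
[cite: Miller2011LMS, Def. 1.1] -/
theorem RowC6.bsdp_rankOne_of_display55_of_cgsThmA (h55 : display55_sha_heegnerIndex)
    (hA : CastellaGrossiSkinner2025.thmA_charIdeal_eq_padicLFunction)
    (hGr : greenberg_charValue_rankZero) (hmodP : nonempty_modularParametrizationData)
    (hnf : exists_isNewformOf) (hHL : HoffsteinLuo1997_exists_twist_L_one_ne_zero)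
    (hGZ : ∀ (N : ℕ) [NeZero N] (W : WeierstrassCurve ℚ) (K : Type) [Field K] [NumberField K],
      gross_zagier N W K)
    (hKo : ∀ (N : ℕ) [NeZero N] (W : WeierstrassCurve ℚ) (K : Type) [Field K] [NumberField K],
      kolyvagin N W K)
    (hGZK : rank_eq_analyticRank_of_analyticRank_le_one)
    (hMaz : mazur_not_dvd_maninConstant_of_odd) (hCassels : bsdRHS_eq_of_isIsogenous)
    (W : WeierstrassCurve ℚ) [W.IsElliptic] [W.IsGloballyMinimal] (p : ℕ) [Fact p.Prime]
    (hp5 : 5 ≤ p) (hgood : Good W p) (hred : Red W p) (hna : ¬ Anom W p) (hr : W.analyticRank = 1) :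
    BSDp W p := by
  have hp : p.Prime := Fact.out
  have hp2 : p ≠ 2 := by omega
  have hmod : hasEntireLFunction_rat := WeierstrassCurve.hasEntireLFunction_rat_of_exists_isNewformOf hnf
  haveI : NeZero (W.conductorNorm ℤ) := ⟨(W.conductorNorm_pos_holds).ne'⟩
  ---------------------------------------------------------------- the optimal curve of the class
  obtain ⟨W₀, hE₀, hM₀, D₀, -, hiso, hmin⟩ :=
    Literature.NumberTheory.Automorphic.exists_optimal_modularParametrizationData_of_modularity hnf
      (W.conductorNorm ℤ) W rfl
  haveI := hE₀
  haveI := hM₀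
  -- `D₀` is lattice-optimal: compare with the unconditional optimal datum of the same newform
  obtain ⟨W₁, hE₁, D₁, hf₁, hlat₁⟩ := D₀.exists_optimalDatum'
  haveI := hE₁
  have hlat₀ : ∀ z ∈ D₀.L.lattice, ∃ w ∈ periodLattice D₀.f, z = D₀.c * w :=
    D₀.latticeEq_of_modularDegree_le D₁ hf₁ hlat₁ (hmin W₁ D₁ hf₁)
  -- Mazur's Cor. 4.1 at the odd good prime `p` (`p ∤ N`, a fortiori `p² ∤ N`)
  have hpN : ¬ p ∣ W.conductorNorm ℤ := fun h ↦
    ((W.dvd_conductorNorm_iff_not_hasGoodReductionAtPrime p).mp h) hgood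
  have hsq : ¬ p ^ 2 ∣ W.conductorNorm ℤ := fun h ↦ hpN ((dvd_pow_self p two_ne_zero).trans h)
  have hc₀ : ¬ (p : ℤ) ∣ D₀.c := hMaz W₀ D₀ hlat₀ p hp hp2 hsq
  -- the level of `D₀` is the conductor of `W₀` as well
  have hN : W.conductorNorm ℤ = W₀.conductorNorm ℤ :=
    IsNewformOf.level_eq_conductorNorm_of_exists_isNewformOf hnf D₀.isNewformOf
  ---------------------------------------------------------------- `W₀` is again in row C6, rank one
  obtain ⟨hgood₀, hred₀, hna₀, hr₀⟩ := RowC6.of_isIsogenous hiso hgood hred hna hr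
  ---------------------------------------------------------------- the admissible field (Hoffstein–Luo)
  have hw₀ : W₀.rootNumber = -1 := by
    have h := even_analyticRank_iff_rootNumber_eq_one.rootNumber_eq_neg_one_pow (W := W₀)
      (even_analyticRank_iff_rootNumber_eq_one_of_exists_isNewformOf W₀ hnf)
    rw [hr₀, pow_one] at h
    exact h
  obtain ⟨K, _, _, hK, hodd, hlt, hHN₀, hHp, hLt⟩ :=
    exists_admissibleField_of_rootNumber_eq_neg_one hnf hHL W₀ hw₀ p
  have hHN : SatisfiesHeegnerHypothesis (W.conductorNorm ℤ) K := by rw [hN]; exact hHN₀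
  ---------------------------------------------------------------- the Heegner datum of `W₀` over `K`
  obtain ⟨β, hβ⟩ := exists_dvd_sq_sub_discr_holds (W.conductorNorm ℤ) K hK hHN
  obtain ⟨H, -⟩ := nonempty_heegnerDatum_holds (W.conductorNorm ℤ) K hK hβ
  obtain ⟨ι⟩ : Nonempty (K →+* ℂ) := inferInstance
  obtain ⟨P, hP⟩ := heegnerPointComplex_mem_range_map_holds (W.conductorNorm ℤ) W₀ K hK hHN D₀ H ι
  ---------------------------------------------------------------- a globally minimal model of the twist
  have hd0 : (NumberField.discr K : ℚ) ≠ 0 := by exact_mod_cast NumberField.discr_ne_zero K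
  obtain ⟨Wd, _, _, C, hC⟩ := exists_isGloballyMinimal_smul_eq_quadraticTwist W₀ hd0
  have hWd : C⁻¹ • W₀.quadraticTwist (NumberField.discr K : ℚ) = Wd := by rw [← hC, inv_smul_smul]
  ---------------------------------------------------------------- `BSD(E₀,p)`, then Cassels
  have h₀ : BSDp W₀ p :=
    RowC6.bsdp_rankOne_at_of_display55_of_cgsThmA h55 hA hGr hmodP W₀ p (W.conductorNorm ℤ) K D₀ H ι P
      (hGZ _ W₀ K) (hKo _ W₀ K) hGZK hmod hp5 hgood₀ hred₀ hna₀ hr₀ hN.symm hK hodd hlt hHN hHp hLt hP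
      hc₀ Wd C⁻¹ hWd
  exact X2.bsdp_of_isIsogenous_of_bsdp hCassels hGZK hmod W₀ W hiso.symm_of_charZero p (by rw [hr₀]) h₀

/-- **Row C6 ∩ {r = 1}, `p ≥ 5`, in the row vocabulary** (`RowC6 W p := 2 < p ∧ Red W p ∧ Good W p ∧
¬ Anom W p`, `Partition/Rows.lean`): `RowC6 W p → 5 ≤ p → ord_{s=1}L(E,s) = 1 → BSDp W p` from the
typed (5.5), the typed Theorem A and published facts (`RowC6.bsdp_rankOne_of_display55_of_cgsThmA`).
[cite: CastellaGrossiSkinner2025, Thm. D (r = 1)] [cite: CastellaGrossiLeeSkinner2022, proof of Thm. 5.3.1, (5.5)] -/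
theorem RowC6.bsdp_rankOne_of_display55_of_cgsThmA' (h55 : display55_sha_heegnerIndex)
    (hA : CastellaGrossiSkinner2025.thmA_charIdeal_eq_padicLFunction)
    (hGr : greenberg_charValue_rankZero) (hmodP : nonempty_modularParametrizationData)
    (hnf : exists_isNewformOf) (hHL : HoffsteinLuo1997_exists_twist_L_one_ne_zero)
    (hGZ : ∀ (N : ℕ) [NeZero N] (W : WeierstrassCurve ℚ) (K : Type) [Field K] [NumberField K],
      gross_zagier N W K)
    (hKo : ∀ (N : ℕ) [NeZero N] (W : WeierstrassCurve ℚ) (K : Type) [Field K] [NumberField K],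
      kolyvagin N W K)
    (hGZK : rank_eq_analyticRank_of_analyticRank_le_one)
    (hMaz : mazur_not_dvd_maninConstant_of_odd) (hCassels : bsdRHS_eq_of_isIsogenous)
    (W : WeierstrassCurve ℚ) [W.IsElliptic] [W.IsGloballyMinimal] (p : ℕ) [Fact p.Prime]
    (hC6 : RowC6 W p) (hp5 : 5 ≤ p) (hr : W.analyticRank = 1) : BSDp W p :=
  RowC6.bsdp_rankOne_of_display55_of_cgsThmA h55 hA hGr hmodP hnf hHL hGZ hKo hGZK hMaz hCassels W p hp5
    hC6.2.2.1 hC6.2.1 hC6.2.2.2 hr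

end Summit.BirchSwinnertonDyer.Rank1Residual

end
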